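import Summits.CriticalPhenomena.CardyFormulaZ2.Theorems.CardyFlipRussoVoronoiHubFromSmirnovBlackPathChain

/-!
# Stub `delaunayChain_along_segment` of line `moebius-exact-delaunay-dilation-ward`
# (crux `VoronoiHubFromSmirnov`, stmt-CriticalPhenomena-6433)

**Delaunay chains along segments** (S3b-i deterministic brick).  Let `τ ⊆ ℂ` be a locally finite
set of nuclei (finite intersection with every compact set), `p, q ∈ τ`, and suppose every point of
the segment `[p, q]` has a nucleus of `τ` within distance `ℓ`.  Then there is a chain of nuclei
`x 0 = p, x 1, …, x N = q` of `τ`, each within distance `ℓ` of the segment, with consecutive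
nuclei Delaunay-adjacent in `τ` (empty circumscribed ball rule,
`Literature.Probability.LatticeModels.IsDelaunayPair`), i.e. a path from `p` to `q` in the
Delaunay graph of `τ` shadowing the segment (Bollobás–Riordan, *Percolation* (CUP 2006), Ch. 8
§8.1: clusters of Voronoi cells ↔ clusters of the Delaunay graph).

Proof.  This is the one-colour case of the landed cell-chain lemma `blackPath_cellChain`, applied
with black AND white nuclei both equal to `τ` (so that the black region is everything and the cells
are the Voronoi cells of `τ ∪ τ = τ`) to the straight path `Path.segment p q`: it yields nuclei
`b 0, …, b k ∈ τ` with `p ∈ cell (b 0)`, `q ∈ cell (b k)` and consecutive cells sharing a point of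
the segment.
* endpoints: `p ∈ τ` lies in the cell of `b 0`, so `dist p (b 0) ≤ dist p p = 0`, i.e. `b 0 = p`;
  likewise `b k = q`;
* proximity: every cell of the chain contains a point `z` of the segment, which has a nucleus
  `w ∈ τ` with `dist z w < ℓ`, whence `dist z (b i) ≤ dist z w < ℓ` by the cell inequality and
  `infDist (b i) [p, q] ≤ dist (b i) z < ℓ`;
* adjacency: consecutive cells meet, which is the Voronoi-dual form of the empty-ball rule
  (`isDelaunayPair_iff_voronoiCell`).

No new definitions; Mathlib only (`Path.segment`, `Path.range_segment`, `Fin.lastCases`).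
-/

noncomputable section

namespace Summit.CriticalPhenomena.CardyFormulaZ2.Cruxes.VoronoiHubFromSmirnov.MoebiusExactDelaunayDilationWard

open Set Metric

open Literature.Probability.LatticeModels (IsDelaunayPair voronoiCell)

/-- **Delaunay chains along segments** (one-colour case of `blackPath_cellChain`;
Bollobás–Riordan 2006, Ch. 8 §8.1): for `τ` locally finite, `p, q ∈ τ`, and every point of the
segment `[p, q]` within distance `ℓ` of `τ`, there is a chain `x 0 = p, …, x N = q` of nuclei of
`τ`, each at distance `< ℓ` from the segment, with consecutive nuclei forming Delaunay pairs of
`τ`. -/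
theorem delaunayChain_along_segment : ∀ (τ : Set ℂ) (p q : ℂ) (ℓ : ℝ), (∀ K : Set ℂ, IsCompact K → (τ ∩ K).Finite) → p ∈ τ → q ∈ τ → 0 < ℓ → (∀ z ∈ segment ℝ p q, ∃ w ∈ τ, dist z w < ℓ) → ∃ (N : ℕ) (x : Fin (N + 1) → ℂ), x 0 = p ∧ x (Fin.last N) = q ∧ (∀ i, x i ∈ τ) ∧ (∀ i, Metric.infDist (x i) (segment ℝ p q) < ℓ) ∧ ∀ i : Fin N, Literature.Probability.LatticeModels.IsDelaunayPair τ (x i.castSucc) (x i.succ) := by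
  intro τ p q ℓ hfin hp hq _hℓ hnear
  -- a nucleus of `τ` whose cell contains another nucleus of `τ` is that nucleus
  have heq : ∀ {a b : ℂ}, a ∈ τ → a ∈ voronoiCell τ b → b = a := fun {a b} ha hab => by
    have h : dist a b ≤ dist a a := hab a ha
    rw [dist_self] at h
    exact (dist_le_zero.1 h).symm
  -- a nucleus whose cell contains a point of the segment is `ℓ`-close to the segment
  have hclose : ∀ {z b : ℂ}, z ∈ segment ℝ p q → z ∈ voronoiCell τ b →
      infDist b (segment ℝ p q) < ℓ := fun {z b} hz hzb => by
    obtain ⟨w, hw, hzw⟩ := hnear z hz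
    calc infDist b (segment ℝ p q) ≤ dist b z := infDist_le_dist_of_mem hz
      _ = dist z b := dist_comm _ _
      _ ≤ dist z w := hzb w hw
      _ < ℓ := hzw
  -- the straight path from `p` to `q` runs inside the segment, and everything is black for `(τ, τ)`
  have hγ : ∀ t, Path.segment p q t ∈ segment ℝ p q := fun t => by
    rw [← Path.range_segment p q]
    exact mem_range_self t
  have hblack : ∀ t, Path.segment p q t ∈ Literature.Probability.Percolation.blackRegion τ τ :=
    fun t => Literature.Probability.Percolation.mem_blackRegion.2 le_rfl
  obtain ⟨k, b, hb, hp0, hql, hstep⟩ :=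
    blackPath_cellChain τ τ p q (Path.segment p q) hfin ⟨p, hp⟩ ⟨p, hp⟩ hblack
  simp only [union_self] at hp0 hql hstep
  refine ⟨k, b, heq hp hp0, heq hq hql, hb, fun i => ?_, fun i => ?_⟩
  · -- proximity: the cell of `b i` contains `q` (last index) or a path point (other indices)
    induction i using Fin.lastCases with
    | last => exact hclose (right_mem_segment ℝ p q) hql
    | cast j =>
      obtain ⟨t, ht, _⟩ := hstep j
      exact hclose (hγ t) ht
  · -- adjacency: consecutive cells share a path point
    obtain ⟨t, ht, ht'⟩ := hstep i
    exact (Literature.Probability.LatticeModels.isDelaunayPair_iff_voronoiCell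
      (hb i.castSucc) (hb i.succ)).2 ⟨_, ht, ht'⟩

end Summit.CriticalPhenomena.CardyFormulaZ2.Cruxes.VoronoiHubFromSmirnov.MoebiusExactDelaunayDilationWard
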